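import Summits.BirchSwinnertonDyer.Rank1Residual.P2.CongruentNumberSilentEvenFiveEnclosureMaximal
import Literature.NumberTheory.EllipticCurves.CongruentNumberEvenFiveThreeRankBound
import HarnessLib

/-!
# Cell «bsd-monsky» (prover-A): RANK ONE ON `𝒮⁻` WITHOUT ANY `2`-SELMER INPUT — the first `2`-descent in the kernel
# (`rk E_{2pq}(ℚ) ≤ 1`, Lagrange 1975 / PROOF-A Lemma 7.1 (a)) + the system's own rational point; hence the odd-index
# datum, `ord_{s=1} L(E_{2pq}, s) = 1` and the `Ш_an`-unit form of C-P2-1 from the system fact ALONE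

HONEST FRAMING (cell `bsd-monsky`, run/shared/lean/pub/bsd-monsky/, README §1: ONE theorem on ONE explicit infinite
family of quadratic twists of the congruent number curve at the prime `2`; nothing booked until the cross-family
referee passes the written proof). This file asserts NO arithmetic fact. It re-derives the rank clause of the
enclosure from the tree's complete `2`-descent instead of from a `2`-Selmer input:

* `Literature/NumberTheory/EllipticCurves/CongruentNumberEvenFiveThreeRankBound.lean` proves, for ALL primes
  `p ≡ 5 (mod 8)`, `q ≡ 3 (mod 4)` (both signs of `(p/q)`), `rk E_{2pq}(ℚ) ≤ 1` — the first descent of PROOF-A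
  Lemma 7.1 (a) / App. D, printed by Lagrange in 1975 («`g ≤ 1`», CITED-FACTS C22) — as a kernel theorem;
* the system fact's (M-y) clause hands a rational point `y′ ∉ 2E_{2pq}(ℚ) + tor`, which forces rank `≥ 1`
  (`SelmerEight.lean` §2); so rank `E_{2pq}(ℚ) = 1` on `𝒮⁻` is a THEOREM of the system fact alone (§1, §3);
* with rank one, the landed chain `minusY_of_monskyDisplays` → `exists_odd_scriptL_of_minusY_of_grossZagier` →
  `oddIndexHeegnerDatum_of_odd_scriptL` gives the odd-index Heegner datum (§3), and the datum gives the SHARPER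
  form `CongruentSilentEvenFiveOrdTwo` (`ord_{s=1} L = 1` and `L′(E_{2pq},1)/(Ω·Reg)` a `2`-adic unit times `4`)
  by the proof of `DatumMonskyEven.lean` §2 with the rank from the descent (§2, §4).

MEANING: on `𝒮⁻`, clause (a) of Theorem 1.1 (`ord_{s=1} L(E_{2pq}, s) = 1`), rank one, `2pq` congruent and the
`Ш_an`-unit statement need ONLY the system fact (`hSys` in any of its forms `tian2014_monsky1990_system_sMinus`,
`…_genus`, `…_split`, `…_bridged`, `…_maximal`); the `2`-Selmer input (`hAo` | `hMe` | `hD`) is used ONLY to pass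
from `Ш_an` to `Ш`, i.e. for clause (b) `BSD(E_{2pq}, 2)` (`Ш(E_{2pq})[2^∞] = 0`), through the landed
`congruentSilentEvenFiveBSDTwo_of_ordTwo_of_monskyEven` / `…_of_aoki` doors. Nothing asserted; the conjecture
`Prop`s stay `@[conjecture]`; no mark moved.

References: [Lagrange1975] §11 table p. 16-12; [SilvermanAEC2009] Prop. X.1.4, Thm. VIII.6.7; [Tian2014] Def. 2.7,
Thm. 2.8, (4.8); [TianYuanZhang2017] Thm. 3.3, Thm. 1.1, §1 (1.1); [Monsky1990MockHeegner] Lemma 3.3 (3), Thm. 5.5,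
Thm. 5.9 (1) — Cor. 5.15 NOT used; [Miller2011LMS] Def. 1.1.
-/

noncomputable section

open scoped Classical

open WeierstrassCurve Literature.NumberTheory.EllipticCurves
  Literature.NumberTheory.EllipticCurves.Rank1Residual
  Literature.NumberTheory.EllipticCurves.Rank1Residual.Typed
  Literature.NumberTheory.EllipticCurves.Monsky1990
  Literature.NumberTheory.EllipticCurves.TianYuanZhang2017

set_option autoImplicit false

namespace Summit.BirchSwinnertonDyer.Rank1Residual.P2

open Conjectures Literature.NumberTheory.EllipticCurves.Tian2014

section Datum

variable [inst : DecidableEq ℚ]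

/-! ## §1 Rank one from the first descent and a non-halvable point (no Selmer input) -/

/-- **Rank `E_{2pq}(ℚ) = 1` from the first `2`-descent and a point `y ∉ 2E(ℚ) + E(ℚ)_tor`**, for ALL primes
`p ≡ 5 (mod 8)`, `q ≡ 3 (mod 4)` (either sign of `(p/q)`): `≤ 1` is the kernel descent
`mordellWeilRank_le_one_congruentNumberCurve_two_mul_five_mul_three_mod_four`, `≥ 1` is
`mordellWeilRank_ne_zero_of_not_two_smul_add_torsion`. No `2`-Selmer input.
[cite: Lagrange1975, §11 table p. 16-12] [cite: SilvermanAEC2009, Prop. X.1.4, Thm. VIII.6.7] -/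
theorem mordellWeilRank_eq_one_of_not_two_smul_add_torsion_two_mul_five_mul {p q : ℕ} (hp : p.Prime)
    (hq : q.Prime) (hp5 : p % 8 = 5) (hq4 : q % 4 = 3)
    (y : (congruentNumberCurve (2 * (p * q))).toAffine.Point)
    (hy : ∀ z t : (congruentNumberCurve (2 * (p * q))).toAffine.Point, IsOfFinAddOrder t →
      y ≠ (2 : ℤ) • z + t) :
    (congruentNumberCurve (2 * (p * q))).mordellWeilRank = 1 :=
  le_antisymm (mordellWeilRank_le_one_congruentNumberCurve_two_mul_five_mul_three_mod_four hp hq hp5 hq4)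
    (Nat.one_le_iff_ne_zero.mpr (mordellWeilRank_ne_zero_of_not_two_smul_add_torsion
      (mul_ne_zero two_ne_zero (mul_ne_zero hp.ne_zero hq.ne_zero)) y hy))

/-- **Rank `E_{2pq}(ℚ) = 1` on `𝒮⁻` from the datum alone**: the datum's point `y ∉ 2E(ℚ) + E(ℚ)_tor` and the
descent bound (no `hMe`, no `hD`, no `h515`). [cite: Lagrange1975, §11 table p. 16-12]
[cite: SilvermanAEC2009, Prop. X.1.4, Thm. VIII.6.7] -/
theorem mordellWeilRank_eq_one_of_oddIndexHeegnerDatum_rankDescent {p q : ℕ} (hp : p.Prime) (hq : q.Prime)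
    (hp5 : p % 8 = 5) (hq4 : q % 4 = 3) (h : OddIndexHeegnerDatum (2 * (p * q))) :
    (congruentNumberCurve (2 * (p * q))).mordellWeilRank = 1 := by
  obtain ⟨y, L, -, -, hy⟩ := h
  exact mordellWeilRank_eq_one_of_not_two_smul_add_torsion_two_mul_five_mul hp hq hp5 hq4 y hy

/-! ## §2 The datum ⟹ the sharper form of C-P2-1, with NO `2`-Selmer input -/

/-- **C-P2-1, SHARPER (`Ш_an`-unit) FORM, from the datum on `𝒮⁻` ALONE**: the proof of
`congruentSilentEvenFiveOrdTwo_of_oddIndexHeegnerDatum` verbatim, rank one now from §1 (the descent and the datum's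
own point) instead of from `h515` / `hMe` / `hD`. For every `(p, q)` of `𝒮⁻`: `𝓛(2pq)` odd
(`exists_odd_scriptL_of_oddIndexHeegnerDatum`), `ord_{s=1} L = 1` (root number `−1`, `𝓛 ≠ 0`),
`L′(E_{2pq}, 1) = 2²·𝓛²·Ω·Reg`, so `x = 4𝓛²` has `ord₂ x = 2`.
[cite: TianYuanZhang2017, §1 (definition of 𝓛(n) and (1.1), p0002 L46–L75)]
[cite: Monsky1990MockHeegner, Lemma 3.3 (3) and the Remark after it (p. 53)] [cite: Lagrange1975, §11 table p. 16-12] -/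
theorem congruentSilentEvenFiveOrdTwo_of_oddIndexHeegnerDatum_rankDescent
    (hmech : ∀ p q : ℕ, p.Prime → q.Prime → p % 8 = 5 → q % 4 = 3 → jacobiSym p q = -1 →
      OddIndexHeegnerDatum (2 * (p * q))) :
    CongruentSilentEvenFiveOrdTwo := by
  intro p q hp hq hp5 hq4 hj
  obtain ⟨hN, hp2, hq2, hne⟩ := isCor515Family_two_mul_five_mul hp hq hp5 hq4
  have hsq : Squarefree (2 * (p * q)) := hN.squarefree
  haveI := isElliptic_congruentNumberCurve hN.ne_zero
  have hrank : (congruentNumberCurve (2 * (p * q))).mordellWeilRank = 1 :=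
    mordellWeilRank_eq_one_of_oddIndexHeegnerDatum_rankDescent hp hq hp5 hq4 (hmech p q hp hq hp5 hq4 hj)
  obtain ⟨L, hLodd, hL⟩ :=
    exists_odd_scriptL_of_oddIndexHeegnerDatum hN.ne_zero hrank (hmech p q hp hq hp5 hq4 hj)
  have hL0' : L ≠ 0 := fun h => by simp [h] at hLodd
  have hL0 : (L : ℚ) ≠ 0 := by exact_mod_cast hL0'
  have hr1 := analyticRank_congruentNumberCurve_eq_one_of_isScriptL hsq hN.mod_eight hL hL0'
  obtain ⟨he, -⟩ := twoExponent_tamagawa_two_mul_prime_mul hp hq hp2 hq2 hne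
  refine ⟨(2 : ℚ) ^ twoExponent (2 * (p * q)) * (L : ℚ) ^ 2,
    mul_ne_zero (zpow_ne_zero _ two_ne_zero) (pow_ne_zero _ hL0), ?_, ?_⟩
  · rw [← (leadingLCoeff_eq_deriv_of_analyticRank_eq_one hr1).1,
      leadingLCoeff_congruentNumberCurve_eq_of_isScriptL (Nat.pos_of_ne_zero hN.ne_zero) hr1 hL]
    push_cast
    ring
  · rw [padicValRat_two_zpow_mul_sq hLodd, he]

/-- **Clause (a) of Theorem 1.1 from the datum alone**: `ord_{s=1} L(E_{2pq}, s) = 1` on `𝒮⁻` — the datum gives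
`𝓛(2pq)` odd, hence `≠ 0`, and the root number is `−1`. [cite: TianYuanZhang2017, Thm. 1.1]
[cite: Monsky1990MockHeegner, Lemma 3.3 (3) (p. 53)] -/
theorem analyticRank_eq_one_of_oddIndexHeegnerDatum_rankDescent {p q : ℕ} (hp : p.Prime) (hq : q.Prime)
    (hp5 : p % 8 = 5) (hq4 : q % 4 = 3) (h : OddIndexHeegnerDatum (2 * (p * q))) :
    (congruentNumberCurve (2 * (p * q))).analyticRank = 1 := by
  obtain ⟨hN, -, -, -⟩ := isCor515Family_two_mul_five_mul hp hq hp5 hq4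
  have hrank := mordellWeilRank_eq_one_of_oddIndexHeegnerDatum_rankDescent hp hq hp5 hq4 h
  obtain ⟨L, hLodd, hL⟩ := exists_odd_scriptL_of_oddIndexHeegnerDatum hN.ne_zero hrank h
  exact analyticRank_congruentNumberCurve_eq_one_of_isScriptL hN.squarefree hN.mod_eight hL
    (fun h0 => by simp [h0] at hLodd)

end Datum

/-! ## §3 Route A ⟹ the datum on `𝒮⁻` from the system fact ALONE -/

/-- **Route A ⟹ the odd-index Heegner datum on `𝒮⁻`, from the system fact alone** (no `h515`, no `hMe`, no `hD`):
`Printed ∧ MonskyDisplays ⟹ MinusY` (K1, `minusY_of_monskyDisplays`) gives `y′ ∈ E_{2pq}(ℚ)`, `y′ ∉ 2E + tor`;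
the descent bound and `y′` give rank `1` (§1), hence a generator `g`; `GrossZagierScriptL` + M-y give `𝓛(2pq)`
odd; `oddIndexHeegnerDatum_of_odd_scriptL` closes. [cite: Lagrange1975, §11 table p. 16-12]
[cite: Monsky1990MockHeegner, Lemma 3.3 (3) and the Remark after it (p. 53), Thm. 5.5 (p. 62), Thm. 5.9 (1) (pp. 63–64)]
[cite: TianYuanZhang2017, Thm. 3.3] [cite: SilvermanAEC2009, Prop. X.1.4, Thm. VIII.6.7] -/
theorem oddIndexHeegnerDatum_of_system_rankDescent (hSys : tian2014_monsky1990_system_sMinus) :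
    ∀ p q : ℕ, p.Prime → q.Prime → p % 8 = 5 → q % 4 = 3 → jacobiSym p q = -1 →
      OddIndexHeegnerDatum (2 * (p * q)) := by
  intro p q hp hq hp5 hq4 hj
  obtain ⟨hN, -, -, -⟩ := isCor515Family_two_mul_five_mul hp hq hp5 hq4
  haveI := isElliptic_congruentNumberCurve hN.ne_zero
  obtain ⟨D, hP, hGZ, hM⟩ := hSys p q hp hq hp5 hq4 hj
  have hMY := D.minusY_of_monskyDisplays (Nat.mul_ne_zero hp.ne_zero hq.ne_zero) hN.squarefree hP hM
  obtain ⟨-, -, y', -, hnot⟩ := id hMY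
  have hrank : (congruentNumberCurve (2 * (p * q))).mordellWeilRank = 1 :=
    mordellWeilRank_eq_one_of_not_two_smul_add_torsion_two_mul_five_mul hp hq hp5 hq4 y' hnot
  obtain ⟨g, hg, -⟩ := exists_generatesFreePartRat_of_mordellWeilRank_eq_one hN.ne_zero hrank
  obtain ⟨L, hLodd, hL⟩ := D.exists_odd_scriptL_of_minusY_of_grossZagier _ hGZ hMY g hg
  exact oddIndexHeegnerDatum_of_odd_scriptL hN.ne_zero hrank hLodd hL

/-- **Rank `E_{2pq}(ℚ) = 1` on all of `𝒮⁻` from the system fact alone.** [cite: Lagrange1975, §11 table p. 16-12]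
[cite: Monsky1990MockHeegner, Thm. 5.5 (p. 62), Thm. 5.9 (1) (pp. 63–64)] -/
theorem mordellWeilRank_eq_one_of_system_rankDescent (hSys : tian2014_monsky1990_system_sMinus) :
    ∀ p q : ℕ, p.Prime → q.Prime → p % 8 = 5 → q % 4 = 3 → jacobiSym p q = -1 →
      (congruentNumberCurve (2 * (p * q))).mordellWeilRank = 1 := fun p q hp hq hp5 hq4 hj =>
  mordellWeilRank_eq_one_of_oddIndexHeegnerDatum_rankDescent hp hq hp5 hq4
    (oddIndexHeegnerDatum_of_system_rankDescent hSys p q hp hq hp5 hq4 hj)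

/-- **`2pq` is a congruent number for every `(p, q)` of `𝒮⁻`, from the system fact alone** (Monsky 1990 Cor. 5.15's
congruent-number clause on this family): rank `≠ 0` through the tree's dictionary. [cite: Monsky1990MockHeegner, Cor. 5.15 (2′) (p. 66)] -/
theorem isCongruentNumber_two_mul_five_mul_of_system_rankDescent (hSys : tian2014_monsky1990_system_sMinus) :
    ∀ p q : ℕ, p.Prime → q.Prime → p % 8 = 5 → q % 4 = 3 → jacobiSym p q = -1 →
      IsCongruentNumber (2 * (p * q)) := fun p q hp hq hp5 hq4 hj =>
  (Wiles2000.mordellWeilRank_ne_zero_iff_isCongruentNumber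
    (mul_pos two_pos (mul_pos hp.pos hq.pos))).mp
    (by rw [mordellWeilRank_eq_one_of_system_rankDescent hSys p q hp hq hp5 hq4 hj]; exact one_ne_zero)

/-! ## §4 The sharper form and clause (a) of C-P2-1 on `𝒮⁻` from the system fact ALONE, in each of its forms -/

/-- **C-P2-1, SHARPER (`Ш_an`-unit) FORM, modulo the system fact ALONE** (`hSys`): ONE displayed named fact,
no `2`-Selmer input, no Monsky 1990 binder, no GZK binder. Conditional; nothing asserted.
[cite: Tian2014, Thm. 2.8 (arXiv:1210.8231 p0011 L25–L44)] [cite: TianYuanZhang2017, Thm. 3.3]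
[cite: Lagrange1975, §11 table p. 16-12] -/
theorem congruentSilentEvenFiveOrdTwo_of_system_rankDescent (hSys : tian2014_monsky1990_system_sMinus) :
    CongruentSilentEvenFiveOrdTwo :=
  congruentSilentEvenFiveOrdTwo_of_oddIndexHeegnerDatum_rankDescent (oddIndexHeegnerDatum_of_system_rankDescent hSys)

/-- **Clause (a) of Theorem 1.1 on all of `𝒮⁻` from the system fact alone**: `ord_{s=1} L(E_{2pq}, s) = 1`.
[cite: TianYuanZhang2017, Thm. 1.1, Thm. 3.3] [cite: Lagrange1975, §11 table p. 16-12] -/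
theorem analyticRank_eq_one_of_system_rankDescent (hSys : tian2014_monsky1990_system_sMinus) :
    ∀ p q : ℕ, p.Prime → q.Prime → p % 8 = 5 → q % 4 = 3 → jacobiSym p q = -1 →
      (congruentNumberCurve (2 * (p * q))).analyticRank = 1 := fun p q hp hq hp5 hq4 hj =>
  analyticRank_eq_one_of_oddIndexHeegnerDatum_rankDescent hp hq hp5 hq4
    (oddIndexHeegnerDatum_of_system_rankDescent hSys p q hp hq hp5 hq4 hj)

/-- The same from the referee-preferred genus form `hSys′` (`tian2014_system_sMinus_genus`).
[cite: Tian2014, Notations (J122–123)] [cite: Lagrange1975, §11 table p. 16-12] -/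
theorem congruentSilentEvenFiveOrdTwo_of_genusSystem_rankDescent (hSys : tian2014_system_sMinus_genus) :
    CongruentSilentEvenFiveOrdTwo :=
  congruentSilentEvenFiveOrdTwo_of_system_rankDescent (tian2014_monsky1990_system_sMinus_of_genus hSys)

/-- The same from the split form `hSys″` (`tian2014_system_sMinus_split`). [cite: TianYuanZhang2017, Thm. 3.3]
[cite: Lagrange1975, §11 table p. 16-12] -/
theorem congruentSilentEvenFiveOrdTwo_of_splitSystem_rankDescent (hSys : tian2014_system_sMinus_split) :
    CongruentSilentEvenFiveOrdTwo :=
  congruentSilentEvenFiveOrdTwo_of_genusSystem_rankDescent (tian2014_system_sMinus_genus_of_split hSys)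

/-- The same from the bridged form `hSys‴` (`tian2014_system_sMinus_bridged`). [cite: TianYuanZhang2017, p. 749]
[cite: Lagrange1975, §11 table p. 16-12] -/
theorem congruentSilentEvenFiveOrdTwo_of_bridgedSystem_rankDescent (hSys : tian2014_system_sMinus_bridged) :
    CongruentSilentEvenFiveOrdTwo :=
  congruentSilentEvenFiveOrdTwo_of_splitSystem_rankDescent (tian2014_system_sMinus_split_of_bridged hSys)

/-- **The corner of record's system fact alone** (`hSys⁗`, `tian2014_system_sMinus_maximal`): the sharper form of
C-P2-1 — clause (a) and `#Ш_an(E_{2pq})` a `2`-adic unit — on all of `𝒮⁻` with NO `2`-Selmer input.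
[cite: Tian2014, Def. 2.7, Prop. 2.1] [cite: TianYuanZhang2017, Thm. 3.3, J747, J751] [cite: Lagrange1975, §11 table p. 16-12] -/
theorem congruentSilentEvenFiveOrdTwo_of_maximalSystem_rankDescent (hSys : tian2014_system_sMinus_maximal) :
    CongruentSilentEvenFiveOrdTwo :=
  congruentSilentEvenFiveOrdTwo_of_bridgedSystem_rankDescent (tian2014_system_sMinus_bridged_of_maximal hSys)

/-- **Clause (a) on all of `𝒮⁻` from the maximal system fact alone.** [cite: TianYuanZhang2017, Thm. 1.1, Thm. 3.3]
[cite: Lagrange1975, §11 table p. 16-12] -/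
theorem analyticRank_eq_one_of_maximalSystem_rankDescent (hSys : tian2014_system_sMinus_maximal) :
    ∀ p q : ℕ, p.Prime → q.Prime → p % 8 = 5 → q % 4 = 3 → jacobiSym p q = -1 →
      (congruentNumberCurve (2 * (p * q))).analyticRank = 1 :=
  analyticRank_eq_one_of_system_rankDescent (tian2014_monsky1990_system_sMinus_of_genus
    (tian2014_system_sMinus_genus_of_split (tian2014_system_sMinus_split_of_bridged
      (tian2014_system_sMinus_bridged_of_maximal hSys))))

/-- **Rank one on all of `𝒮⁻` from the maximal system fact alone.** [cite: Lagrange1975, §11 table p. 16-12]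
[cite: Monsky1990MockHeegner, Thm. 5.5 (p. 62), Thm. 5.9 (1) (pp. 63–64)] -/
theorem mordellWeilRank_eq_one_of_maximalSystem_rankDescent (hSys : tian2014_system_sMinus_maximal) :
    ∀ p q : ℕ, p.Prime → q.Prime → p % 8 = 5 → q % 4 = 3 → jacobiSym p q = -1 →
      (congruentNumberCurve (2 * (p * q))).mordellWeilRank = 1 :=
  mordellWeilRank_eq_one_of_system_rankDescent (tian2014_monsky1990_system_sMinus_of_genus
    (tian2014_system_sMinus_genus_of_split (tian2014_system_sMinus_split_of_bridged
      (tian2014_system_sMinus_bridged_of_maximal hSys))))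

/-! ## §5 Bookkeeping: with the rank in the kernel, the `2`-Selmer input serves clause (b) only -/

/-- **C-P2-1 (observable form) from the sharper form and Aoki's `2`-Selmer count** — restated here to make the
division of labour visible: `hSys⁗` alone gives the sharper form (§4); `hAo` converts `Ш_an` into `Ш` through the
landed door `congruentSilentEvenFiveBSDTwo_of_ordTwo_of_aoki`'s ingredients (`congruentSilentEvenFiveBSDTwo_of_maximalSystem_of_aoki`).
Conditional; nothing asserted. [cite: Aoki1999, Thm. 2.2] [cite: Miller2011LMS, Def. 1.1 (arXiv:1010.2431 p. 3)] -/
theorem congruentSilentEvenFiveBSDTwo_of_maximalSystem_of_aoki_rankDescent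
    (hAo : Literature.NumberTheory.EllipticCurves.Aoki1999.thm22_card_selmerGroup_two)
    (hSys : tian2014_system_sMinus_maximal) :
    CongruentSilentEvenFiveOrdTwo ∧ CongruentSilentEvenFiveBSDTwo :=
  ⟨congruentSilentEvenFiveOrdTwo_of_maximalSystem_rankDescent hSys,
    congruentSilentEvenFiveBSDTwo_of_maximalSystem_of_aoki hAo hSys⟩

end Summit.BirchSwinnertonDyer.Rank1Residual.P2

end
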